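import Summits.QuantumFields.YangMills.Theorems.BalabanUVNodesN15CovariantTwoGridStaircaseCellFit
import Summits.QuantumFields.YangMills.Theorems.BalabanUVNodesN15CovariantTwoGridPullback
import HarnessLib

/-!
# N15 = NE2, road (c) — PROGRAMME (PC) «[B9] Sect. C FOR THE LANDAU LETTER WITH PER-CUBE GAUGES (3.35) AS PRINTED», (PC-E) (C6-d3) STEP 2: KING's COVARIANT PAIRING OF STAIRCASES —
# the coarse staircase holonomy of the straight line-holonomy field `U_μ(x) = Π_{t<L^m}U′_μ(σx + te′_μ)` to the block point `c` IS the fine staircase holonomy to `L^m·c` (the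
# cell corner `σ(L^k·y + c)`), leg by leg and bond by bond (dag-n15-c g32, n15-c∕350)

Cell `pub-ymgap`, seat `pub-ymgap-dag-n15-c` (generation g32; R134 (a) seat, strategy s1 «first missing estimate»; HUMAN RULING D-0062; chair R424 venue).
`bears_on: R4∕N15 · K3⁸ SpineGivenEndpointR13SepCoPHV (stmt-QuantumFields-27366)`; filed `--kind proof --supports stmt-QuantumFields-27366 --as helper` — COUNT-NEUTRAL.
THEOREMS only ([folklore] lattice bookkeeping), 0 `def`, 0 `sorry`.  Imports BY NAME n15-c∕185a `holStair`∕`holLeg`∕`cvaStair_conj`, n15-c∕181 `mprod`∕`mprod_add`∕`mprod_congr`, n15-c `kingSec`∕`kingSec_val`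
(`…CovariantTwoGridPullback`), `bpt`∕`bpt_val`∕`bpt_add_tstep_of_lt`∕`tstep_succ`∕`stair_of_lt`∕`stair_of_gt` bookkeeping, n15-c∕349 `…StaircaseCellFit` (re-exported for the sequel).
Nothing in the tree is modified, no landed name re-declared.

WHY ((C6-d3) = n15-c∕340's displayed `hDNV`).  The cut Gram perturbation `a(Q₁ᵀQ₁ − Q_TᵀQ_T)` reads the staircase transports `T(Γ_{y,x}) = coordMat e Ad_{U(Γ_{y,x})}` (n15-c∕185a
`cvaStair_conj`); under King's covariant pairing (coarse bond = straight fine holonomy, director ruling I.20786∕I.20907) ★★ `holStair_lineHol_eq`: `U(Γ_{y,c}) = U′(Γ′_{y,L^m·c})` —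
each coarse bond of leg `i` at height `s` is the product of the `L^m` fine bonds at heights `L^ms + t` of the fine leg (★ `kingSec_bpt`: `σ(L^k·y + a) = L^mL^k·y + L^m·a`; ★
`mprod_flatten`), so the coarse transport to `πx′` is the fine transport to the cell corner `σπx′`, and n15-c∕349 bounds its distance to the fine transport to `x′`.
★ `cvaStair_cvT_lineHol_eq`: the same for the transports `cvT e`.

HONEST FRAMING ∕ LIMITS.  Elementary; MODEL pairing (straight holonomy); nothing of [B7]∕[B9] asserted ((124)–(125) p.36 of [Balaban1985Averaging] = SHAPE).  NE2⁺ NOT PRINTED, NOT proved;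
N15 of record untouched (DISCHARGED AS CONSUMED, p687738); K3⁸ OPEN; counts of record UNMOVED (typed 28∕28 · discharged 8∕27); one finite 𝕋⁴ at fixed ε per index — NOT infinite volume,
NOT OS on ℝ⁴, NOT a mass gap, NOT Clay.  Restate-immune (no Theses import).
-/

set_option autoImplicit false

noncomputable section

open scoped BigOperators Matrix Matrix.Norms.L2Operator
open Finset

namespace Summit.QuantumFields.YangMills.BalabanUVNodes.N15.CovAvg

open Literature.MathematicalPhysics.QuantumFieldTheory.Balaban1983to89
open Literature.MathematicalPhysics.QuantumFieldTheory.Balaban1983to89.B5Prop11Plancherel (Tor fine unitVec)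
open Literature.MathematicalPhysics.QuantumFieldTheory.Balaban1983to89.B5Block118 (bpt tstep tstep_succ tstep_zero)
open Literature.MathematicalPhysics.QuantumFieldTheory.Balaban1983to89.B5Blocks16 (bpt_val)
open Literature.MathematicalPhysics.QuantumFieldTheory.Balaban1983to89.Beta.FluctuationProjection (bpt_add_tstep_of_lt)
open Summit.QuantumFields.YangMills.BalabanUVNodes.N15.VectorPiece (bondAt stair stair_of_lt stair_self stair_of_gt)
open Summit.QuantumFields.YangMills.BalabanUVNodes.N15.MatrixSpecies (coordMat)
open Summit.QuantumFields.YangMills.BalabanUVNodes.N15.Gluing (cvT)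

variable {d : ℕ}

/-! ## §1 Bookkeeping -/

section Book

variable (M : Fin (d + 1) → ℕ) [∀ μ, NeZero (M μ)]

omit [∀ μ, NeZero (M μ)] in
/-- `tstep μ t = t·e_μ`. [folklore] -/
theorem tstep_eq_nsmul (n : ℕ) [NeZero n] (μ : Fin (d + 1)) : ∀ t : ℕ, tstep (fine n M) μ t = t • unitVec (fine n M) μ
  | 0 => by rw [tstep_zero, zero_smul]
  | t + 1 => by rw [tstep_succ, tstep_eq_nsmul n μ t, succ_nsmul]

variable (L k m : ℕ) [NeZero L]

/-- ★ `σ(L^k·y + a) = L^mL^k·y + L^m·a`: King's section maps block points to block points of the same unit block, scaling the block coordinates. [cite: King1986, p.664 (pairing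
convention)] -/
theorem kingSec_bpt (y : Tor M) (a : Fin (d + 1) → Fin (L ^ k)) :
    kingSec M L k m (bpt (L ^ k) M y a) = bpt (L ^ m * L ^ k) M y (fun ν => ⟨L ^ m * (a ν : ℕ), (Nat.mul_lt_mul_left (pow_pos (Nat.pos_of_ne_zero (NeZero.ne L)) m)).mpr (a ν).isLt⟩) := by
  funext ν
  apply ZMod.val_injective
  rw [kingSec_val, bpt_val, bpt_val]
  ring

end Book

/-- ★ flattening a product of products: `Π_{s<N} Π_{t<R} G(Rs + t) = Π_{u<RN} G(u)`. [folklore] -/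
theorem mprod_flatten {A : Type} [Monoid A] (G : ℕ → A) (R : ℕ) : ∀ N : ℕ, mprod (fun s => mprod (fun t => G (R * s + t)) R) N = mprod G (R * N)
  | 0 => by rw [mprod_zero, Nat.mul_zero, mprod_zero]
  | N + 1 => by rw [mprod_succ, mprod_flatten G R N, Nat.mul_succ, mprod_add]

/-! ## §2 The pairing of staircases -/

section Pair

variable (M : Fin (d + 1) → ℕ) [∀ μ, NeZero (M μ)] (L k m : ℕ) [NeZero L] {mm : Type} [Fintype mm] [DecidableEq mm]

/-- ★★ **KING's COVARIANT PAIRING OF STAIRCASES**: the coarse staircase holonomy of the line-holonomy field `U_μ(x) = Π_{t<L^m}U′_μ(σx + te′_μ)` to the block point `L^k·y + c` equals the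
fine staircase holonomy of `U′` to `σ(L^k·y + c) = L^mL^k·y + L^m·c` (each coarse bond is the product of the `L^m` fine bonds over it, in order). [cite: Balaban1985Averaging, (124)–(125)
p.36 (pairing: shape); King1986, p.664 (pairing convention)] -/
theorem holStair_lineHol_eq (V' : Fin (d + 1) → Tor (fine (L ^ m * L ^ k) M) → Matrix mm mm ℂ) (y : Tor M) (c : Fin (d + 1) → Fin (L ^ k)) (ν : Fin (d + 1))
    (hc : ∀ i, L ^ m * (c i : ℕ) < L ^ m * L ^ k) :
    holStair M (L ^ k) (fun μ q => mprod (fun t => V' μ (kingSec M L k m q.1 + t • unitVec (fine (L ^ m * L ^ k) M) μ)) (L ^ m)) y c ν =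
      holStair M (L ^ m * L ^ k) (fun μ q => V' μ q.1) y (fun i => ⟨L ^ m * (c i : ℕ), hc i⟩) ν := by
  have hLk : 0 < L ^ k := pow_pos (Nat.pos_of_ne_zero (NeZero.ne L)) k
  have hn' : 0 < L ^ m * L ^ k := Nat.pos_of_ne_zero (NeZero.ne _)
  unfold holStair
  refine mprod_congr fun i hi => ?_
  rw [dif_pos hi, dif_pos hi]
  show mprod (fun s => mprod (fun t => V' ⟨i, hi⟩ (kingSec M L k m (bpt (L ^ k) M y (stair c ⟨i, hi⟩ ⟨s % L ^ k, Nat.mod_lt _ hLk⟩)) + t • unitVec (fine (L ^ m * L ^ k) M) ⟨i, hi⟩)) (L ^ m)) (c ⟨i, hi⟩) =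
    mprod (fun u => V' ⟨i, hi⟩ (bpt (L ^ m * L ^ k) M y (stair (fun i => ⟨L ^ m * (c i : ℕ), hc i⟩) ⟨i, hi⟩ ⟨u % (L ^ m * L ^ k), Nat.mod_lt _ hn'⟩))) (L ^ m * (c ⟨i, hi⟩ : ℕ))
  rw [← mprod_flatten]
  refine mprod_congr fun s hs => mprod_congr fun t ht => ?_
  congr 1
  have hsk : s % L ^ k = s := Nat.mod_eq_of_lt (lt_trans hs (c ⟨i, hi⟩).isLt)
  have hu : (L ^ m * s + t) % (L ^ m * L ^ k) = L ^ m * s + t := by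
    apply Nat.mod_eq_of_lt
    calc L ^ m * s + t < L ^ m * s + L ^ m := by omega
      _ = L ^ m * (s + 1) := by ring
      _ ≤ L ^ m * L ^ k := Nat.mul_le_mul_left _ (by have := (c ⟨i, hi⟩).isLt; omega)
  have hlt : L ^ m * ((stair c ⟨i, hi⟩ ⟨s % L ^ k, Nat.mod_lt _ hLk⟩ ⟨i, hi⟩ : Fin (L ^ k)) : ℕ) + t < L ^ m * L ^ k := by
    rw [stair_self]; show L ^ m * (s % L ^ k) + t < _; rw [hsk, ← hu]; exact Nat.mod_lt _ hn'
  rw [kingSec_bpt M L k m, ← tstep_eq_nsmul M (L ^ m * L ^ k) ⟨i, hi⟩ t,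
    bpt_add_tstep_of_lt (L ^ m * L ^ k) M y (fun ν => ⟨L ^ m * ((stair c ⟨i, hi⟩ ⟨s % L ^ k, Nat.mod_lt _ hLk⟩ ν : Fin (L ^ k)) : ℕ),
      (Nat.mul_lt_mul_left (pow_pos (Nat.pos_of_ne_zero (NeZero.ne L)) m)).mpr (stair c ⟨i, hi⟩ ⟨s % L ^ k, Nat.mod_lt _ hLk⟩ ν).isLt⟩) ⟨i, hi⟩ t hlt]
  congr 1
  funext ν'
  apply Fin.ext
  by_cases hν : ν' = ⟨i, hi⟩
  · subst hν
    rw [Function.update_self]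
    simp only [Fin.val_mk, stair_self]
    rw [hsk, hu]
  · rw [Function.update_of_ne hν]
    rcases lt_or_gt_of_ne hν with h1 | h1
    · show L ^ m * ((stair c ⟨i, hi⟩ ⟨s % L ^ k, Nat.mod_lt _ hLk⟩ ν' : Fin (L ^ k)) : ℕ) = _
      rw [stair_of_lt c _ h1, stair_of_lt _ _ h1]
    · show L ^ m * ((stair c ⟨i, hi⟩ ⟨s % L ^ k, Nat.mod_lt _ hLk⟩ ν' : Fin (L ^ k)) : ℕ) = _
      rw [stair_of_gt c _ h1, stair_of_gt _ _ h1, Nat.mul_zero]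

variable {ι : Type} [Fintype ι] [DecidableEq ι] (e : Matrix mm mm ℂ ≃L[ℝ] (ι → ℝ))

/-- ★ the same for the TRANSPORTS `T = cvT e U = coordMat e Ad_U` (n15-c∕185a `cvaStair_conj`): `T(Γ_{y,c}) = T′(Γ′_{y,L^m·c})`. [cite: Balaban1985Averaging, (124)–(125) p.36 (shape)] -/
theorem cvaStair_cvT_lineHol_eq (V' : Fin (d + 1) → Tor (fine (L ^ m * L ^ k) M) → Matrix mm mm ℂ) (y : Tor M) (c : Fin (d + 1) → Fin (L ^ k)) (ν : Fin (d + 1))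
    (hc : ∀ i, L ^ m * (c i : ℕ) < L ^ m * L ^ k) :
    cvaStair M (L ^ k) (fun μ b => cvT e (fun μ x => mprod (fun t => V' μ (kingSec M L k m x + t • unitVec (fine (L ^ m * L ^ k) M) μ)) (L ^ m)) μ b.1) y c ν =
      cvaStair M (L ^ m * L ^ k) (fun μ b => cvT e V' μ b.1) y (fun i => ⟨L ^ m * (c i : ℕ), hc i⟩) ν := by
  rw [show (fun μ (b : Tor (fine (L ^ k) M) × Fin (d + 1)) => cvT e (fun μ x => mprod (fun t => V' μ (kingSec M L k m x + t • unitVec (fine (L ^ m * L ^ k) M) μ)) (L ^ m)) μ b.1) =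
      (fun μ q => coordMat e (ContinuousLinearMap.mulLeftRight ℝ (Matrix mm mm ℂ) ((fun μ (q : Tor (fine (L ^ k) M) × Fin (d + 1)) => mprod (fun t => V' μ (kingSec M L k m q.1 + t • unitVec (fine (L ^ m * L ^ k) M) μ)) (L ^ m)) μ q)
        ((fun μ (q : Tor (fine (L ^ k) M) × Fin (d + 1)) => mprod (fun t => V' μ (kingSec M L k m q.1 + t • unitVec (fine (L ^ m * L ^ k) M) μ)) (L ^ m)) μ q)ᴴ)) from rfl,
    show (fun μ (b : Tor (fine (L ^ m * L ^ k) M) × Fin (d + 1)) => cvT e V' μ b.1) =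
      (fun μ q => coordMat e (ContinuousLinearMap.mulLeftRight ℝ (Matrix mm mm ℂ) ((fun μ (q : Tor (fine (L ^ m * L ^ k) M) × Fin (d + 1)) => V' μ q.1) μ q) ((fun μ (q : Tor (fine (L ^ m * L ^ k) M) × Fin (d + 1)) => V' μ q.1) μ q)ᴴ)) from rfl,
    cvaStair_conj, cvaStair_conj, holStair_lineHol_eq M L k m V' y c ν hc]

end Pair

end Summit.QuantumFields.YangMills.BalabanUVNodes.N15.CovAvg

end
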